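import Literature.Analysis.FluidPDE.SelfSimilarEulerBernoulliCap
import HarnessLib

/-!
# On its irrotational set the self-similar Lagrangian flow is the gradient flow of `ℋ/(2γ−1)`

Analysis/FluidPDE proofs file (theorems only), a short complement to the Bernoulli-landscape files
(`SelfSimilarEulerBernoulliGradient` … `SelfSimilarEulerBernoulliCap`) on `C²` stationary
self-similar Euler profiles `(U, P)` (Constantin–Ignatova–Vicol 2026, arXiv:2602.17570, (3.3);
`V = γ(y − c) + U`, Bernoulli function `ℋ` (3.30)). CIV's (3.29) reads `∇ℋ = −(1−2γ)V − Ω × V`;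
hence WHEREVER THE VORTICITY VANISHES, `∇ℋ = (2γ − 1) V`: the self-similar transport field is a
gradient there, `V = ∇(ℋ/(2γ−1))` (`γ ≠ ½`) — for `γ < ½` the steepest DESCENT of `ℋ/(1−2γ)`.

* `IsSelfSimilarEulerProfile.fderiv_selfSimilarBernoulli_apply_of_curl_eq_zero`,
  `…gradient_selfSimilarBernoulli_of_curl_eq_zero`, `…selfSimilarTransport_eq_smul_gradient` —
  the pointwise statements at a point `y` with `curl U y = 0` (from the adjoint-free gradient
  formula `fderiv_selfSimilarBernoulli_apply` and the symmetry of `DU(y)`,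
  `isSymmetric_fderiv_of_curl_eq_zero`);
* `IsSelfSimilarEulerProfile.exists_bernoulliCap_gradientFlow` — combined with the irrotational
  Bernoulli cap (`exists_irrotational_bernoulliCap`): for `0 < γ < ½` and a `C²` profile with the
  far-field bounds (3.8) there is `t < max ℋ` such that on the cap `{ℋ > t}` (a nonempty open
  neighbourhood of the Bernoulli-top stagnation point) the flow is irrotational AND
  `V = (2γ−1)⁻¹ ∇ℋ`: near its Bernoulli top a putative in-window self-similar collapse is a
  potential SOURCE flow descending the Bernoulli landscape from its summit.

## References

* P. Constantin, M. Ignatova, V. Vicol, arXiv:2602.17570 (2026), §3.4.3 (3.29)–(3.31).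
  [ConstantinIgnatovaVicol2026Putative]
-/

noncomputable section

open Set Filter Topology InnerProductSpace Metric
open scoped RealInnerProductSpace

namespace Literature.Analysis.FluidPDE

namespace IsSelfSimilarEulerProfile

variable {γ : ℝ} {c : EuclideanSpace ℝ (Fin 3)}
  {U : EuclideanSpace ℝ (Fin 3) → EuclideanSpace ℝ (Fin 3)} {P : EuclideanSpace ℝ (Fin 3) → ℝ}

/-- **Where the vorticity vanishes, `Dℋ = (2γ−1)⟪V, ·⟫`** (CIV (3.29) with `Ω(y) = 0`): at a
point `y` with `curl U y = 0` the velocity gradient `DU(y)` is symmetric, so the two transport terms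
of `fderiv_selfSimilarBernoulli_apply` cancel. [cite: ConstantinIgnatovaVicol2026Putative, §3.4.3 eq. (3.29)] -/
theorem fderiv_selfSimilarBernoulli_apply_of_curl_eq_zero (h : IsSelfSimilarEulerProfile γ c U P)
    {y : EuclideanSpace ℝ (Fin 3)} (hΩ : curl U y = 0) (w : EuclideanSpace ℝ (Fin 3)) :
    fderiv ℝ (selfSimilarBernoulli γ c U P) y w = (2 * γ - 1) * ⟪selfSimilarTransport γ c U y, w⟫ := by
  have hUd : Differentiable ℝ U := h.differentiable_velocity
  have hS := isSymmetric_fderiv_of_curl_eq_zero (hUd y) hΩ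
  rw [h.fderiv_selfSimilarBernoulli_apply]
  have : ⟪fderiv ℝ U y (selfSimilarTransport γ c U y), w⟫ =
      ⟪selfSimilarTransport γ c U y, fderiv ℝ U y w⟫ := hS _ _
  rw [this, sub_self, add_zero]

/-- **Where the vorticity vanishes, `∇ℋ = (2γ−1) V`.** [cite: ConstantinIgnatovaVicol2026Putative, §3.4.3 eq. (3.29)] -/
theorem gradient_selfSimilarBernoulli_of_curl_eq_zero (h : IsSelfSimilarEulerProfile γ c U P)
    {y : EuclideanSpace ℝ (Fin 3)} (hΩ : curl U y = 0) :
    gradient (selfSimilarBernoulli γ c U P) y = (2 * γ - 1) • selfSimilarTransport γ c U y := by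
  refine ext_inner_right ℝ fun w => ?_
  rw [inner_gradient_left, h.fderiv_selfSimilarBernoulli_apply_of_curl_eq_zero hΩ, inner_smul_left,
    conj_trivial]

/-- **Where the vorticity vanishes the transport field is a gradient: `V = (2γ−1)⁻¹ ∇ℋ`**
(`γ ≠ ½`). For `γ < ½` this is `V = −∇(ℋ/(1−2γ))`: the self-similar Lagrangian flow is the steepest
descent of the Bernoulli function. [cite: ConstantinIgnatovaVicol2026Putative, §3.4.3 eq. (3.29)–(3.31)] -/
theorem selfSimilarTransport_eq_smul_gradient (h : IsSelfSimilarEulerProfile γ c U P)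
    (hγ : γ ≠ 1 / 2) {y : EuclideanSpace ℝ (Fin 3)} (hΩ : curl U y = 0) :
    selfSimilarTransport γ c U y = (2 * γ - 1)⁻¹ • gradient (selfSimilarBernoulli γ c U P) y := by
  have h2 : 2 * γ - 1 ≠ 0 := by intro h0; apply hγ; linarith
  rw [h.gradient_selfSimilarBernoulli_of_curl_eq_zero hΩ, smul_smul, inv_mul_cancel₀ h2, one_smul]

/-- **The Bernoulli cap is a potential source flow.** For `0 < γ < ½` and a `C²` profile with the
far-field bounds (3.8) there is a level `t` below the maximum of `ℋ` (attained at a stagnation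
point `z`) such that on the Bernoulli cap `{ℋ > t} ∋ z` the vorticity vanishes and the self-similar
transport field is the gradient `V = (2γ−1)⁻¹ ∇ℋ` — the flow near the Bernoulli top descends the
Bernoulli landscape from its summit `z`. (`exists_irrotational_bernoulliCap` + the pointwise
statements above.) [cite: ConstantinIgnatovaVicol2026Putative, §3.4.3–§3.5 (sharpened; not in print)] -/
theorem exists_bernoulliCap_gradientFlow (h : IsSelfSimilarEulerProfile γ c U P)
    (hγ : 0 < γ) (hγ2 : γ < 1 / 2) {C : ℝ} (hfar : HasSelfSimilarFarFieldWith γ c C U) :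
    ∃ t : ℝ, (∃ z ∈ selfSimilarNodalSet γ c U, t < selfSimilarBernoulli γ c U P z ∧
        IsMaxOn (selfSimilarBernoulli γ c U P) univ z) ∧
      ∀ y, t < selfSimilarBernoulli γ c U P y → curl U y = 0 ∧
        selfSimilarTransport γ c U y = (2 * γ - 1)⁻¹ • gradient (selfSimilarBernoulli γ c U P) y := by
  obtain ⟨t, htop, hcap⟩ := h.exists_irrotational_bernoulliCap hγ hγ2 hfar
  have hγne : γ ≠ 1 / 2 := by intro h0; linarith
  exact ⟨t, htop, fun y hy => ⟨hcap y hy, h.selfSimilarTransport_eq_smul_gradient hγne (hcap y hy)⟩⟩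

end IsSelfSimilarEulerProfile

end Literature.Analysis.FluidPDE

end
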